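import Literature.Geometry.DiscreteGeometry.SphericalCodeHullEulerFormula
import Literature.Geometry.DiscreteGeometry.KissingRhombusPairing
import HarnessLib

/-!
# Very long hull edges of the Delaunay polyhedron of a kissing configuration: at most one of the
# two facets through such an edge has a vertex in contact with both its endpoints
# (Hales 2012, proof of Theorem 2: two regions of type `(2,0,1)` never share their long edge)

Topic `Literature/Geometry/DiscreteGeometry`; provefact brick for `Hales2012_contactGraphTame`,
continuing `KissingRhombusPairing.lean` (imports only the hull machinery and the pairing lemma).  In the superadditivity
step of the proof of Theorem 2 a Delaunay triangle of type `(2,0,1)` (an isosceles contact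
triangle on a long base, whose penalty may vanish) has to be paired with the triangle on the
other side of its base, which is then NOT of that type.  For the bases that are hull edges this
file provides the pairing at the level of the two facets through the edge:

* `HasApex X c e`: some vertex of the facet of `c`, not in `e`, is in contact with both points of
  `e`; `IsVeryLong e`: `e = {b, x}` with `⟪b, x⟫ < 0` (length `> 2√2` on `S²(2)`);
  `edgeDeficit X c e = [IsVeryLong e ∧ HasApex X c e]`,
  `edgeSupply X c e = [IsVeryLong e ∧ ¬HasApex X c e]` (real indicators).
* `eq_of_three_mem_tightSet`: two facets sharing three vertices coincide.
* `not_hasApex_and_hasApex`: for a very long hull edge `e` and the two facets `c₁ ≠ c₂` through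
  it, not both have an apex (`inner_pos_of_rhombus_tight`); hence
  `sum_edgeDeficit_le_sum_edgeSupply_of_mem_hullEdges` (per hull edge, over its two facets) and
  **`sum_sum_edgeDeficit_le`**: `Σ_c Σ_{e ∈ edgesOfFacet c} edgeDeficit ≤ Σ_c Σ_e edgeSupply`.

Everything is PROVED; no named facts.  The companion count for the diagonals of the facets and
the census drawn from both are in `KissingContactCount.lean`.

## References
* T. C. Hales, arXiv:1209.6043 (2012), proof of Theorem 2 (superadditivity of `d₃`: "we cannot
  have `(r₁,s₁,t₁) = (r₂,s₂,t₂) = (2,0,1)`"). [`Hales2012`]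
-/

noncomputable section

namespace Literature.Geometry.DiscreteGeometry

open Real RealInnerProductSpace Finset

section EdgeDeficit

local notation "E3" => EuclideanSpace ℝ (Fin 3)

variable {X : Finset E3}

/-! ### Part A. Apexes, very long pairs, deficit and supply of a facet at an edge -/

/-- **The facet of `c` has an apex over `e`**: some vertex of the facet, not in `e`, is in
contact (inner product `1/2`) with every point of `e`. [folklore] -/
def HasApex (X : Finset E3) (c : E3) (e : Finset E3) : Prop :=
  ∃ v ∈ tightSet X c, v ∉ e ∧ ∀ y ∈ e, ⟪v, y⟫ = 1 / 2

/-- **`e` is a very long pair**: `e = {b, x}` with `⟪b, x⟫ < 0` (on `S²(2)`: length `> 2√2`).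
[folklore] -/
def IsVeryLong (e : Finset E3) : Prop := ∃ b x : E3, e = {b, x} ∧ ⟪b, x⟫ < 0

open Classical in
/-- The deficit indicator of the facet of `c` at `e`: `1` if `e` is very long and the facet has
an apex over it (its fan triangle at `e` may be of type `(2,0,1)`), else `0`. [folklore] -/
def edgeDeficit (X : Finset E3) (c : E3) (e : Finset E3) : ℝ :=
  if IsVeryLong e ∧ HasApex X c e then 1 else 0

open Classical in
/-- The supply indicator of the facet of `c` at `e`: `1` if `e` is very long and the facet has NO
apex over it (its fan triangle at `e` has at most one contact side), else `0`. [folklore] -/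
def edgeSupply (X : Finset E3) (c : E3) (e : Finset E3) : ℝ :=
  if IsVeryLong e ∧ ¬HasApex X c e then 1 else 0

/-- `IsVeryLong {b, x} ↔ ⟪b, x⟫ < 0`. [folklore] -/
theorem isVeryLong_pair_iff {b x : E3} : IsVeryLong ({b, x} : Finset E3) ↔ ⟪b, x⟫ < 0 := by
  constructor
  · rintro ⟨b', x', heq, hlt⟩
    have hb'x' : b' ≠ x' := fun h => by
      rw [h, real_inner_self_eq_norm_sq] at hlt
      exact absurd hlt (not_lt.2 (sq_nonneg _))
    have hmem : ∀ y ∈ ({b, x} : Finset E3), y ∈ ({b', x'} : Finset E3) := fun y hy => heq ▸ hy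
    have hmem' : ∀ y ∈ ({b', x'} : Finset E3), y ∈ ({b, x} : Finset E3) := fun y hy => heq ▸ hy
    have hb := hmem b (mem_insert_self _ _)
    have hx := hmem x (mem_insert_of_mem (mem_singleton_self _))
    have hb' := hmem' b' (mem_insert_self _ _)
    have hx' := hmem' x' (mem_insert_of_mem (mem_singleton_self _))
    rw [mem_insert, mem_singleton] at hb hx hb' hx'
    rcases hb with rfl | rfl
    · -- `b = b'`
      rcases hx with rfl | rfl
      · -- `x = b'` too: then `x' ∈ {b'}`, contradiction
        rcases hx' with h | h
        · exact absurd h.symm hb'x'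
        · exact absurd h.symm hb'x'
      · exact hlt
    · -- `b = x'`
      rcases hx with rfl | rfl
      · rw [real_inner_comm]; exact hlt
      · rcases hb' with h | h
        · exact absurd h hb'x'
        · exact absurd h hb'x'
  · intro h
    exact ⟨b, x, rfl, h⟩

/-! ### Part B. Two facets sharing three vertices coincide -/

/-- Three distinct vertices of a facet are linearly independent (they lie on a circle not
through the origin; `orient3_facetVertex_pos` after sorting). [folklore] -/
theorem linearIndependent_of_three_tight (hX1 : ∀ y ∈ X, ‖y‖ = 1) {c : E3}
    (hc : c ∈ facetNormals X) {y₁ y₂ y₃ : E3} (h₁ : y₁ ∈ tightSet X c) (h₂ : y₂ ∈ tightSet X c)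
    (h₃ : y₃ ∈ tightSet X c) (h12 : y₁ ≠ y₂) (h13 : y₁ ≠ y₃) (h23 : y₂ ≠ y₃) :
    LinearIndependent ℝ ![y₁, y₂, y₃] := by
  set hc0 := ne_zero_of_mem_facetNormals hX1 hc
  obtain ⟨i, hi, rfl⟩ := exists_facetVertex_eq hX1 hc0 h₁
  obtain ⟨j, hj, rfl⟩ := exists_facetVertex_eq hX1 hc0 h₂
  obtain ⟨k, hk, rfl⟩ := exists_facetVertex_eq hX1 hc0 h₃
  have hij : i ≠ j := fun h => h12 (by rw [h])
  have hik : i ≠ k := fun h => h13 (by rw [h])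
  have hjk : j ≠ k := fun h => h23 (by rw [h])
  apply linearIndependent_of_orient3_ne_zero
  -- sort the three indices; the orientation of a permutation differs by a sign
  have hpos := fun (a b d : ℕ) (hab : a < b) (hbd : b < d) (hd : d < (facetAngles X c hc0).card) =>
    orient3_facetVertex_pos hX1 hc hab hbd hd
  rcases Nat.lt_or_gt_of_ne hij with hij' | hij' <;> rcases Nat.lt_or_gt_of_ne hjk with hjk' | hjk'
    <;> rcases Nat.lt_or_gt_of_ne hik with hik' | hik'
  · exact (hpos i j k hij' hjk' hk).ne'
  · omega
  · -- `i < j`, `k < j`, `i < k`: order `i < k < j`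
    rw [orient3_swap_right]; exact neg_ne_zero.2 (hpos i k j hik' hjk' hj).ne'
  · -- `k < i < j`
    rw [← orient3_cyclic]; exact (hpos k i j hik' hij' hj).ne'
  · -- `j < i`, `j < k`, `i < k`: order `j < i < k`
    rw [orient3_swap_left]; exact neg_ne_zero.2 (hpos j i k hij' hik' hk).ne'
  · -- `j < i`, `j < k`, `k < i`: order `j < k < i`
    rw [orient3_cyclic]; exact (hpos j k i hjk' hik' hi).ne'
  · omega
  · -- `j < i`, `k < j`: order `k < j < i`
    rw [orient3_swap_outer]; exact neg_ne_zero.2 (hpos k j i hjk' hij' hi).ne'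

/-- **Two facets sharing three vertices coincide** (a facet normal is determined by its values on
a basis). [folklore] -/
theorem eq_of_three_mem_tightSet (hX1 : ∀ y ∈ X, ‖y‖ = 1) {c₁ c₂ : E3}
    (hc₁ : c₁ ∈ facetNormals X) {y₁ y₂ y₃ : E3}
    (h₁ : y₁ ∈ tightSet X c₁) (h₂ : y₂ ∈ tightSet X c₁) (h₃ : y₃ ∈ tightSet X c₁)
    (h₁' : y₁ ∈ tightSet X c₂) (h₂' : y₂ ∈ tightSet X c₂) (h₃' : y₃ ∈ tightSet X c₂)
    (h12 : y₁ ≠ y₂) (h13 : y₁ ≠ y₃) (h23 : y₂ ≠ y₃) : c₁ = c₂ := by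
  have hli := linearIndependent_of_three_tight hX1 hc₁ h₁ h₂ h₃ h12 h13 h23
  have hz : c₁ - c₂ = 0 := by
    refine eq_zero_of_inner_linearIndependent_fin_three hli fun i => ?_
    fin_cases i
    · show ⟪c₁ - c₂, y₁⟫ = 0
      rw [inner_sub_left, (mem_tightSet.1 h₁).2, (mem_tightSet.1 h₁').2, sub_self]
    · show ⟪c₁ - c₂, y₂⟫ = 0
      rw [inner_sub_left, (mem_tightSet.1 h₂).2, (mem_tightSet.1 h₂').2, sub_self]
    · show ⟪c₁ - c₂, y₃⟫ = 0
      rw [inner_sub_left, (mem_tightSet.1 h₃).2, (mem_tightSet.1 h₃').2, sub_self]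
  exact sub_eq_zero.1 hz

/-! ### Part C. The pairing across a very long hull edge -/

/-- **At most one of the two facets through a very long hull edge has an apex over it.**  If
`c₁ ≠ c₂` are facet normals whose tight sets both contain `b ≠ x` with `⟪b, x⟫ < 0`, then
`HasApex X c₁ {b,x}` and `HasApex X c₂ {b,x}` cannot both hold: the two apexes `v₁, v₂` would
form with `b, x` a rhombus of side `60°` with `v₁, b, x` on the facet of `c₁` and `⟪c₁, v₂⟫ < 1`,
forcing `⟪b, x⟫ > 0` (`inner_pos_of_rhombus_tight`). [cite: Hales2012, proof of Theorem 2
(superadditivity of d₃)] -/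
theorem not_hasApex_and_hasApex (hX1 : ∀ y ∈ X, ‖y‖ = 1) {c₁ c₂ : E3}
    (hc₁ : c₁ ∈ facetNormals X) (hne : c₁ ≠ c₂) {b x : E3}
    (hb₁ : b ∈ tightSet X c₁) (hx₁ : x ∈ tightSet X c₁) (hb₂ : b ∈ tightSet X c₂)
    (hx₂ : x ∈ tightSet X c₂) (hbx : b ≠ x) (hvl : ⟪b, x⟫ < 0) :
    ¬(HasApex X c₁ {b, x} ∧ HasApex X c₂ {b, x}) := by
  rintro ⟨⟨v₁, hv₁, hv₁e, hv₁c⟩, ⟨v₂, hv₂, hv₂e, hv₂c⟩⟩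
  have hv₁b := hv₁c b (mem_insert_self _ _)
  have hv₁x := hv₁c x (mem_insert_of_mem (mem_singleton_self _))
  have hv₂b := hv₂c b (mem_insert_self _ _)
  have hv₂x := hv₂c x (mem_insert_of_mem (mem_singleton_self _))
  have hv₁nb : v₁ ≠ b := fun h => hv₁e (h ▸ mem_insert_self _ _)
  have hv₁nx : v₁ ≠ x := fun h => hv₁e (h ▸ mem_insert_of_mem (mem_singleton_self _))
  have hv₂nb : v₂ ≠ b := fun h => hv₂e (h ▸ mem_insert_self _ _)
  have hv₂nx : v₂ ≠ x := fun h => hv₂e (h ▸ mem_insert_of_mem (mem_singleton_self _))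
  -- `v₂` is not a vertex of the facet of `c₁` (else the facets share `v₂, b, x`)
  have hv₂c₁ : v₂ ∉ tightSet X c₁ := fun h =>
    hne (eq_of_three_mem_tightSet hX1 hc₁ h hb₁ hx₁ hv₂ hb₂ hx₂ hv₂nb hv₂nx hbx)
  have hv₁v₂ : v₁ ≠ v₂ := fun h => hv₂c₁ (h ▸ hv₁)
  have hv₂X : v₂ ∈ X := (mem_tightSet.1 hv₂).1
  have hcv₂ : ⟪c₁, v₂⟫ < 1 := by
    have hle : ⟪c₁, v₂⟫ ≤ 1 := (mem_facetNormals.1 hc₁).1 v₂ hv₂X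
    refine lt_of_le_of_ne hle fun h => hv₂c₁ ?_
    exact mem_tightSet.2 ⟨hv₂X, h⟩
  have hpos := inner_pos_of_rhombus_tight (hX1 v₁ (mem_tightSet.1 hv₁).1) (hX1 v₂ hv₂X)
    (hX1 b (mem_tightSet.1 hb₁).1) (hX1 x (mem_tightSet.1 hx₁).1) hv₁b hv₁x hv₂b hv₂x hv₁v₂ hbx
    (mem_tightSet.1 hv₁).2 hcv₂ (mem_tightSet.1 hb₁).2 (mem_tightSet.1 hx₁).2
  linarith

/-- **Per hull edge: the deficits of the two facets through it are covered by their supplies**: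
`Σ_{c ∈ facetsOfEdge X e} edgeDeficit X c e ≤ Σ_{c ∈ facetsOfEdge X e} edgeSupply X c e`.
[cite: Hales2012, proof of Theorem 2 (superadditivity of d₃)] -/
theorem sum_edgeDeficit_le_sum_edgeSupply_of_mem_hullEdges (hX1 : ∀ y ∈ X, ‖y‖ = 1)
    (h0 : (0 : E3) ∈ interior (convexHull ℝ (X : Set E3))) {e : Finset E3} (he : e ∈ hullEdges X) :
    ∑ c ∈ facetsOfEdge X e, edgeDeficit X c e ≤ ∑ c ∈ facetsOfEdge X e, edgeSupply X c e := by
  classical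
  by_cases hvl : IsVeryLong e
  · obtain ⟨c₁, c₂, hne, hpair⟩ := Finset.card_eq_two.1 (card_facetsOfEdge hX1 h0 he)
    have hc₁ : c₁ ∈ facetsOfEdge X e := by rw [hpair]; exact mem_insert_self _ _
    have hc₂ : c₂ ∈ facetsOfEdge X e := by
      rw [hpair]; exact mem_insert_of_mem (mem_singleton_self _)
    unfold facetsOfEdge at hc₁ hc₂
    rw [mem_filter] at hc₁ hc₂
    rw [hpair, sum_pair hne, sum_pair hne]
    -- the endpoints
    obtain ⟨b, x, rfl, hlt⟩ := hvl
    have hbx : b ≠ x := fun h => by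
      rw [h, real_inner_self_eq_norm_sq] at hlt
      exact absurd hlt (not_lt.2 (sq_nonneg _))
    have hb₁ : b ∈ tightSet X c₁ := hc₁.2 (mem_insert_self _ _)
    have hx₁ : x ∈ tightSet X c₁ := hc₁.2 (mem_insert_of_mem (mem_singleton_self _))
    have hb₂ : b ∈ tightSet X c₂ := hc₂.2 (mem_insert_self _ _)
    have hx₂ : x ∈ tightSet X c₂ := hc₂.2 (mem_insert_of_mem (mem_singleton_self _))
    have hnand := not_hasApex_and_hasApex hX1 hc₁.1 hne hb₁ hx₁ hb₂ hx₂ hbx hlt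
    have hvl' : IsVeryLong ({b, x} : Finset E3) := ⟨b, x, rfl, hlt⟩
    unfold edgeDeficit edgeSupply
    by_cases hA₁ : HasApex X c₁ {b, x} <;> by_cases hA₂ : HasApex X c₂ {b, x}
    · exact absurd ⟨hA₁, hA₂⟩ hnand
    · rw [if_pos ⟨hvl', hA₁⟩, if_neg (fun h => hA₂ h.2), if_neg (fun h => h.2 hA₁),
        if_pos ⟨hvl', hA₂⟩]
      norm_num
    · rw [if_neg (fun h => hA₁ h.2), if_pos ⟨hvl', hA₂⟩, if_pos ⟨hvl', hA₁⟩,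
        if_neg (fun h => h.2 hA₂)]
      norm_num
    · rw [if_neg (fun h => hA₁ h.2), if_neg (fun h => hA₂ h.2), if_pos ⟨hvl', hA₁⟩,
        if_pos ⟨hvl', hA₂⟩]
      norm_num
  · have h1 : ∀ c, edgeDeficit X c e = 0 := fun c => if_neg fun h => hvl h.1
    have h2 : ∀ c, edgeSupply X c e = 0 := fun c => if_neg fun h => hvl h.1
    rw [Finset.sum_congr rfl fun c _ => h1 c, Finset.sum_congr rfl fun c _ => h2 c]

/-- **Summed over the facets and their hull edges, the deficits are covered by the supplies**:
`Σ_c Σ_{e ∈ edgesOfFacet c} edgeDeficit ≤ Σ_c Σ_{e ∈ edgesOfFacet c} edgeSupply` (swap the sums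
to hull edges and their two facets). [cite: Hales2012, proof of Theorem 2 (superadditivity)] -/
theorem sum_sum_edgeDeficit_le (hX1 : ∀ y ∈ X, ‖y‖ = 1)
    (h0 : (0 : E3) ∈ interior (convexHull ℝ (X : Set E3))) :
    ∑ c ∈ facetNormals X, ∑ e ∈ edgesOfFacet X c, edgeDeficit X c e ≤
      ∑ c ∈ facetNormals X, ∑ e ∈ edgesOfFacet X c, edgeSupply X c e := by
  classical
  have hswap : ∀ f : E3 → Finset E3 → ℝ,
      ∑ c ∈ facetNormals X, ∑ e ∈ edgesOfFacet X c, f c e =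
        ∑ e ∈ hullEdges X, ∑ c ∈ facetsOfEdge X e, f c e := by
    intro f
    refine Finset.sum_comm' fun c e => ?_
    simp only [edgesOfFacet, facetsOfEdge, mem_filter]
    tauto
  rw [hswap, hswap]
  exact Finset.sum_le_sum fun e he => sum_edgeDeficit_le_sum_edgeSupply_of_mem_hullEdges hX1 h0 he

end EdgeDeficit

end Literature.Geometry.DiscreteGeometry

end
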